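import Summits.QuantumFields.BalabanUV.Beta.FP.NestedDressingLegs
import Summits.QuantumFields.BalabanUV.Beta.FP.PerfectGaugeDefectBottomDressed
import Summits.QuantumFields.BalabanUV.Beta.SymmetrisedDressingLegs

/-!
# `BalabanUV.Beta.FP.NestedDressingDress` — road «FP» for binder row D1, W-ORACLE-K row **SLOT** (owner d1-p3 gen 15, memo `N2B-DESIGN.md` v3.1 §11 (11a)), PART 2 of 3:
# BI-LOCALISATION UNDER THE NESTED LEG DRESSINGS (SAME RATE), THE BOND SLOT `coProjNestAtK`, AND THE NESTED DRESSING FUNCTOR `dressNestAt : JetData d N → JetData d N`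
# (blocking `N`, window `Lc^M`) — decl-by-decl twins of an2's `SymmetrisedDressingLegs` §3, `SymmetrisedDressingKernel` (`comp_piKSymBm_inr`, `colH_coDressKSymAt`) and
# `SymmetrisedDressingDress` §4∕§6 with `piKSymBm ρ N ↦ piKSymNest ρ Lc M`

HONEST DEPENDENCY (page 1, mandatory): continuum YM on T⁴ ⇐ BetaPertH ∧ nine spine estimates (0/9 proved); BetaPertH ⇐ (D1) ∧ (D4) ∧ CAP+tail;
G-an2-4 gates asym, D1 and NE2/3/4.  HONEST FRAMING (cell contract, verbatim): «discharging `BetaPertH` makes Bałaban's UV stability UNCONDITIONAL —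
a real constructive-QFT result; it is NOT the continuum limit and NOT the Clay problem.»  THIS MODULE DISCHARGES NOTHING of the wall: [folklore] window bounds and
finite sums; plumbing definitions `cKnest`, `cKnest'` (constants), `coProjNestAtK` (the bond-slot action on `MKer`-valued families), `dressNestAt` (the functor on
`OneStepResolventKernel.JetData` — [our object], a CANDIDATE dressing of jets asserting nothing); no `def … : Prop`, nothing cited, 0 sorry; 0∕4 row-D1 binders; NOT SLOT
itself (PART 3 `FP/NestedDressingSlot`: the vertex transfer and `hessKer_dressNestAt`), NOT (SDF), NOT D1, NOT `BetaPertH`, NOT continuum, NOT Clay.  «not in print; our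
bookkeeping».

ABSOLUTE RULE (cell charter, verbatim): «No internally-minted statement may enter as a cited fact. Every hypothesis is either kernel-proved in
this package or a verbatim quotation of a PUBLISHED theorem with page reference. The manuscript(s) under audit are NOT citable for their own
disputed steps — they are the thing under adjudication; programme-internal (2001/route/tribunal) claims are never citable.»

CONTENT (generic `d`; window `cube (d+1) (Lc^M)`, in-block root `r ∈ box (d+1) Lc`, `1 ≤ Lc`): §0 `comp_piKSymNest_inr` (right composition with `Π̂_nest` fixes a multiplier
column), `colH_coDressKNestAt` (the `ℋ`-column of the co-dressed kernel is the FILE-7 window image of the `ℋ`-column); §1 `one_le_cWnest`, `cKnest`, `one_le_cKnest`, `cKnest'`;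
§2 `biLoc_legCo₁NestAt` ∕ `biLoc_legCo₂NestAt` ∕ `biLoc_dressKNestAt` (constant `cKnest` per leg, SAME rate); §3 `coProjNestAtK` (+ `_eval`), `locStencil_coProjNestAtK`,
`locStencil_dressKNestAt`; §4 **`dressNestAt`** (+ `_S`, `_W`, `_δ`).
Provenance: road FP swarm LEAF PROVER `b2b-balaban-beta-d1-formalise-leaf-06` gen 15, 2026-08-21, row SLOT (first refusal leaf-06 ∕ an2); the mathematics is an2's
(β sub-cell, `SymmetrisedDressing*`, gen 26), ported by script.  Names PROVISIONAL.
-/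

open Finset
open scoped BigOperators
open Literature.MathematicalPhysics.QuantumFieldTheory
open Literature.MathematicalPhysics.QuantumFieldTheory.Balaban1983to89
open Literature.MathematicalPhysics.QuantumFieldTheory.Balaban1983to89.Beta
open B12Sec2to5 (l1 l1_nonneg)
open ExpKernelCalculus (MKer Decays BiLoc comp tr shiftK l1_sub_triangle l1_sub_symm)
open AffineAveraging (Form0 Form1 box toSite unitVec unitVec_apply)
open AxialDressing (exp_recenter_le)
open OneStepResolventKernel (Fib LocStencil JetData wsum)
open OneStepKernelFamily (colH vertexOfK)
open Summit.QuantumFields.BalabanUV.Beta.TameKernelCalculus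
open Summit.QuantumFields.BalabanUV.Beta.AxialDressingRooted
open Summit.QuantumFields.BalabanUV.Beta.FP.NestedDressingKernel (pmSymNest piKSymNest piKSymNest_inl_inl piKSymNest_inl_inr piKSymNest_inr_inl piKSymNest_inr_inr)
open Summit.QuantumFields.BalabanUV.Beta.FP.PerfectGaugeDefectBottomDressed (sum_piKSymNest_col_inl)
open Summit.QuantumFields.BalabanUV.Beta.FP.NestedDressingLegs

namespace Summit.QuantumFields.BalabanUV.Beta.FP.NestedDressingDress

noncomputable section

variable {d : ℕ}

/-! ## §0 Right composition on a multiplier column; the `ℋ`-column of the co-dressed kernel -/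

section Column

variable (ρ : Fin (d + 1) → ℤ) (Lc M : ℕ) (N : ℕ)

/-- [folklore] Right composition with `piKSymNest` does not touch a multiplier column. -/
theorem comp_piKSymNest_inr (A : MKer (d + 1) (Fib d)) (x y : Fin (d + 1) → ℤ) (a : Fib d) (μ : Fin (d + 1)) :
    comp A (piKSymNest ρ Lc M) x y a (Sum.inr μ) = A x y a (Sum.inr μ) := by
  unfold ExpKernelCalculus.comp
  have h : ∀ y', ∑ f : Fib d, A x y' a f * piKSymNest ρ Lc M y' y f (Sum.inr μ) = if y' = y then A x y' a (Sum.inr μ) else 0 := by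
    intro y'
    rw [Fintype.sum_sum_type]
    simp only [piKSymNest_inl_inr, piKSymNest_inr_inr, mul_zero, Finset.sum_const_zero, zero_add]
    by_cases hy : y' = y
    · simp only [hy, true_and, mul_ite, mul_one, mul_zero, Finset.sum_ite_eq', Finset.mem_univ, if_true]
    · simp [hy]
  simp_rw [h]
  rw [tsum_point']

/-- [folklore] The `ℋ`-column of the co-dressed kernel is the windowed `Π^{(M)}_nest`-image of the `ℋ`-column of `K`. -/
theorem colH_coDressKNestAt (K : MKer (d + 1) (Fib d)) (μ : Fin (d + 1)) (y : Fin (d + 1) → ℤ) (κ' : Fin (d + 1)) (u' : Fin (d + 1) → ℤ) :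
    colH (coDressKNestAt ρ Lc M K) N μ y κ' u' =
      ∑ v ∈ cube (d + 1) (Lc ^ M), ∑ κ : Fin (d + 1), pmSymNest ρ Lc M κ' u' κ (u' - v) * colH K N μ y κ (u' - v) := by
  unfold colH
  rw [coDressKNestAt_eq, comp_piKSymNest_inr]
  unfold ExpKernelCalculus.comp
  simp only [trK]
  have h : ∀ u, ∑ f : Fib d, piKSymNest ρ Lc M u u' f (Sum.inl κ') * K u ((N : ℤ) • y) f (Sum.inr μ) =
      if u' - u ∈ cube (d + 1) (Lc ^ M) then
        ∑ κ : Fin (d + 1), pmSymNest ρ Lc M κ' u' κ u * K u ((N : ℤ) • y) (Sum.inl κ) (Sum.inr μ) else 0 := fun u =>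
    sum_piKSymNest_col_inl ρ Lc M u u' κ' (fun f => K u ((N : ℤ) • y) f (Sum.inr μ))
  simp_rw [h]
  rw [tsum_window']

end Column


/-! ## §1 The window constants with the recentring exponent -/

section Consts

/-- [folklore] `1 ≤ cWnest`. -/
theorem one_le_cWnest (d Lc M : ℕ) : 1 ≤ cWnest d Lc M := by
  have h1 : (1 : ℝ) ≤ (((2 * Lc ^ M + 1) ^ (d + 1) : ℕ) : ℝ) := by
    exact_mod_cast Nat.one_le_pow _ _ (by omega)
  have h2 : (1 : ℝ) ≤ ((d : ℝ) + 1) * (1 + 4 * ((d : ℝ) + 1) * ((M : ℝ) * (Lc : ℝ) ^ M)) := by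
    have a : (1 : ℝ) ≤ (d : ℝ) + 1 := by
      have : (0 : ℝ) ≤ d := Nat.cast_nonneg d
      linarith
    have b : (1 : ℝ) ≤ 1 + 4 * ((d : ℝ) + 1) * ((M : ℝ) * (Lc : ℝ) ^ M) := by
      have : (0 : ℝ) ≤ 4 * ((d : ℝ) + 1) * ((M : ℝ) * (Lc : ℝ) ^ M) := by positivity
      linarith
    nlinarith
  unfold cWnest
  calc (1 : ℝ) = 1 * 1 := (mul_one 1).symm
    _ ≤ _ := mul_le_mul h1 h2 zero_le_one (zero_le_one.trans h1)

/-- [our object, plumbing] THE LEG CONSTANT with the window recentring exponent: `cWnest · e^{δ(d+1)Lc^M}` (an2's `cKnest d Lc M δ` one level up). -/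
def cKnest (d Lc M : ℕ) (δ : ℝ) : ℝ := cWnest d Lc M * Real.exp (δ * (((d : ℝ) + 1) * (Lc : ℝ) ^ M))

/-- [folklore] `1 ≤ cKnest` (`0 ≤ δ`). -/
theorem one_le_cKnest (d Lc M : ℕ) {δ : ℝ} (hδ : 0 ≤ δ) : 1 ≤ cKnest d Lc M δ := by
  have h12 := one_le_cWnest d Lc M
  have h3 : (1 : ℝ) ≤ Real.exp (δ * (((d : ℝ) + 1) * (Lc : ℝ) ^ M)) := Real.one_le_exp (by positivity)
  unfold cKnest
  calc (1 : ℝ) = 1 * 1 := (mul_one 1).symm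
    _ ≤ _ := mul_le_mul h12 h3 zero_le_one (zero_le_one.trans h12)

/-- [our object, plumbing] THE BOND-SLOT CONSTANT: `cWnest · e^{2δ(d+1)Lc^M}` (an2's `cKnest' d Lc M δ` one level up). -/
def cKnest' (d Lc M : ℕ) (δ : ℝ) : ℝ := cWnest d Lc M * Real.exp (2 * δ * (((d : ℝ) + 1) * (Lc : ℝ) ^ M))

end Consts

/-! ## §2 Bi-localisation survives the nested leg dressings (same rate) -/

section LegBounds







/-- [folklore] **FIRST-LEG NESTED DRESSING PRESERVES BI-LOCALISATION:** `BiLoc K p q C δ ⇒ BiLoc (legCo₁NestAt ρ Lc M K) p q (cKb·C) δ`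
(in-block root `ρ = toSite r`, `1 ≤ N`, `0 ≤ δ`). -/
theorem biLoc_legCo₁NestAt {Lc : ℕ} (hLc : 1 ≤ Lc) {r : Fin (d + 1) → ℕ} (hr : r ∈ box (d + 1) Lc) (M : ℕ)
    {K : MKer (d + 1) (Fib d)} {p q : Fin (d + 1) → ℤ} {C δ : ℝ}
    (h : BiLoc K p q C δ) (hδ : 0 ≤ δ) : BiLoc (legCo₁NestAt (toSite r) Lc M K) p q (cKnest d Lc M δ * C) δ := by
  have hC : 0 ≤ C := h.nonneg (Sum.inl 0)
  intro x y a b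
  cases a with
  | inr m =>
    rw [legCo₁NestAt_inr]
    calc |K x y (Sum.inr m) b| ≤ C * Real.exp (-δ * (l1 (x - p) + l1 (y - q))) := h x y _ b
      _ ≤ cKnest d Lc M δ * C * Real.exp (-δ * (l1 (x - p) + l1 (y - q))) := by
          have h1 := one_le_cKnest d Lc M hδ
          have h2 : 0 ≤ C * Real.exp (-δ * (l1 (x - p) + l1 (y - q))) := by positivity
          nlinarith
  | inl α =>
    rw [legCo₁NestAt_inl]
    have hM : ∀ (κ : Fin (d + 1)) (v : Fin (d + 1) → ℤ), v ∈ cube (d + 1) (Lc ^ M) →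
        |K (x + v) y (Sum.inl κ) b| ≤ C * Real.exp (δ * (((d : ℝ) + 1) * (Lc ^ M : ℕ))) * Real.exp (-δ * (l1 (x - p) + l1 (y - q))) :=
      fun κ v hv => (h (x + v) y _ b).trans (exp_recenter_le (l1_sub_window_le x hv) hC hδ)
    calc |coProjNestAtT (toSite r) Lc M (fun α' x' => K x' y (Sum.inl α') b) α x|
        ≤ cWnest d Lc M * (C * Real.exp (δ * (((d : ℝ) + 1) * (Lc ^ M : ℕ))) * Real.exp (-δ * (l1 (x - p) + l1 (y - q)))) :=
          abs_coProjNestAtT_le hLc hr M _ α x hM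
      _ = cKnest d Lc M δ * C * Real.exp (-δ * (l1 (x - p) + l1 (y - q))) := by
          unfold cKnest
          push_cast
          ring

/-- [folklore] **SECOND-LEG NESTED DRESSING PRESERVES BI-LOCALISATION.** -/
theorem biLoc_legCo₂NestAt {Lc : ℕ} (hLc : 1 ≤ Lc) {r : Fin (d + 1) → ℕ} (hr : r ∈ box (d + 1) Lc) (M : ℕ)
    {K : MKer (d + 1) (Fib d)} {p q : Fin (d + 1) → ℤ} {C δ : ℝ}
    (h : BiLoc K p q C δ) (hδ : 0 ≤ δ) : BiLoc (legCo₂NestAt (toSite r) Lc M K) p q (cKnest d Lc M δ * C) δ := by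
  have hC : 0 ≤ C := h.nonneg (Sum.inl 0)
  intro x y a b
  cases b with
  | inr m =>
    rw [legCo₂NestAt_inr]
    calc |K x y a (Sum.inr m)| ≤ C * Real.exp (-δ * (l1 (x - p) + l1 (y - q))) := h x y a _
      _ ≤ cKnest d Lc M δ * C * Real.exp (-δ * (l1 (x - p) + l1 (y - q))) := by
          have h1 := one_le_cKnest d Lc M hδ
          have h2 : 0 ≤ C * Real.exp (-δ * (l1 (x - p) + l1 (y - q))) := by positivity
          nlinarith
  | inl β =>
    rw [legCo₂NestAt_inl]
    have hM : ∀ (κ : Fin (d + 1)) (v : Fin (d + 1) → ℤ), v ∈ cube (d + 1) (Lc ^ M) →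
        |K x (y + v) a (Sum.inl κ)| ≤ C * Real.exp (δ * (((d : ℝ) + 1) * (Lc ^ M : ℕ))) * Real.exp (-δ * (l1 (y - q) + l1 (x - p))) := by
      intro κ v hv
      have h1 := h x (y + v) a (Sum.inl κ)
      rw [add_comm (l1 (x - p)) (l1 (y + v - q))] at h1
      exact h1.trans (exp_recenter_le (l1_sub_window_le y hv) hC hδ)
    calc |coProjNestAtT (toSite r) Lc M (fun β' y' => K x y' a (Sum.inl β')) β y|
        ≤ cWnest d Lc M * (C * Real.exp (δ * (((d : ℝ) + 1) * (Lc ^ M : ℕ))) * Real.exp (-δ * (l1 (y - q) + l1 (x - p)))) :=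
          abs_coProjNestAtT_le hLc hr M _ β y hM
      _ = cKnest d Lc M δ * C * Real.exp (-δ * (l1 (x - p) + l1 (y - q))) := by
          unfold cKnest
          rw [add_comm (l1 (y - q))]
          push_cast
          ring

/-- [folklore] **THE NESTED KERNEL DRESSING PRESERVES BI-LOCALISATION:** `BiLoc K p q C δ ⇒ BiLoc (dressKNestAt ρ Lc M K) p q (cKb²·C) δ`. -/
theorem biLoc_dressKNestAt {Lc : ℕ} (hLc : 1 ≤ Lc) {r : Fin (d + 1) → ℕ} (hr : r ∈ box (d + 1) Lc) (M : ℕ)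
    {K : MKer (d + 1) (Fib d)} {p q : Fin (d + 1) → ℤ} {C δ : ℝ}
    (h : BiLoc K p q C δ) (hδ : 0 ≤ δ) : BiLoc (dressKNestAt (toSite r) Lc M K) p q (cKnest d Lc M δ * (cKnest d Lc M δ * C)) δ := by
  rw [dressKNestAt_eq_legs]
  exact biLoc_legCo₂NestAt hLc hr M (biLoc_legCo₁NestAt hLc hr M h hδ) hδ

end LegBounds

/-! ## §3 The bond slot: `Π̂ᵀ_nest` on the `MKer`-valued stencil family -/

section BondSlot

/-- [folklore] `Π̂ᵀ_nest` on an `MKer`-valued bond family, entrywise: `(Π̂ᵀ_nest S) κ u x y a b := Π̂ᵀ_nest (S · · x y a b) κ u`. -/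
def coProjNestAtK (ρ : Fin (d + 1) → ℤ) (Lc M : ℕ)
    (S : Fin (d + 1) → (Fin (d + 1) → ℤ) → MKer (d + 1) (Fib d)) :
    Fin (d + 1) → (Fin (d + 1) → ℤ) → MKer (d + 1) (Fib d) :=
  fun κ u x y a b => coProjNestAtT ρ Lc M (fun κ' u' => S κ' u' x y a b) κ u

/-- [folklore] Evaluation at a kernel entry commutes with `Π̂ᵀ_nest` (by definition). -/
theorem coProjNestAtK_eval (ρ : Fin (d + 1) → ℤ) (Lc M : ℕ)
    (S : Fin (d + 1) → (Fin (d + 1) → ℤ) → MKer (d + 1) (Fib d))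
    (κ : Fin (d + 1)) (u x y : Fin (d + 1) → ℤ) (a b : Fib d) :
    coProjNestAtK ρ Lc M S κ u x y a b = coProjNestAtT ρ Lc M (fun κ' u' => S κ' u' x y a b) κ u := rfl





/-- [folklore] **THE NESTED BOND-SLOT DRESSING PRESERVES `LocStencil`:** `LocStencil S Cs δ ⇒ LocStencil (Π̂ᵀ_nest S) (cKb'·Cs) δ`. -/
theorem locStencil_coProjNestAtK {Lc : ℕ} (hLc : 1 ≤ Lc) {r : Fin (d + 1) → ℕ} (hr : r ∈ box (d + 1) Lc) (M : ℕ)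
    {S : Fin (d + 1) → (Fin (d + 1) → ℤ) → MKer (d + 1) (Fib d)} {Cs δ : ℝ}
    (hS : LocStencil S Cs δ) (hδ : 0 ≤ δ) : LocStencil (coProjNestAtK (toSite r) Lc M S) (cKnest' d Lc M δ * Cs) δ := by
  have hC : 0 ≤ Cs := (hS 0 0).nonneg (Sum.inl 0)
  intro κ u x y a b
  rw [coProjNestAtK_eval]
  have hM : ∀ (κ' : Fin (d + 1)) (v : Fin (d + 1) → ℤ), v ∈ cube (d + 1) (Lc ^ M) →
      |S κ' (u + v) x y a b| ≤ Cs * Real.exp (2 * δ * (((d : ℝ) + 1) * (Lc : ℝ) ^ M)) * Real.exp (-δ * (l1 (x - u) + l1 (y - u))) := by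
    intro κ' v hv
    have hr' : l1 ((u + v) - u) ≤ ((d : ℝ) + 1) * (Lc : ℝ) ^ M := by
      rw [add_sub_cancel_left]
      have h := l1_le_of_mem_cube hv
      push_cast at h
      exact h
    have tx : l1 (x - u) ≤ l1 (x - (u + v)) + l1 ((u + v) - u) := l1_sub_triangle x (u + v) u
    have ty : l1 (y - u) ≤ l1 (y - (u + v)) + l1 ((u + v) - u) := l1_sub_triangle y (u + v) u
    calc |S κ' (u + v) x y a b| ≤ Cs * Real.exp (-δ * (l1 (x - (u + v)) + l1 (y - (u + v)))) := hS κ' (u + v) x y a b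
      _ ≤ Cs * (Real.exp (2 * δ * (((d : ℝ) + 1) * (Lc : ℝ) ^ M)) * Real.exp (-δ * (l1 (x - u) + l1 (y - u)))) := by
          refine mul_le_mul_of_nonneg_left ?_ hC
          rw [← Real.exp_add]
          exact Real.exp_le_exp.2 (by nlinarith)
      _ = Cs * Real.exp (2 * δ * (((d : ℝ) + 1) * (Lc : ℝ) ^ M)) * Real.exp (-δ * (l1 (x - u) + l1 (y - u))) := by ring
  calc |coProjNestAtT (toSite r) Lc M (fun κ' u' => S κ' u' x y a b) κ u|
      ≤ cWnest d Lc M * (Cs * Real.exp (2 * δ * (((d : ℝ) + 1) * (Lc : ℝ) ^ M)) * Real.exp (-δ * (l1 (x - u) + l1 (y - u)))) :=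
        abs_coProjNestAtT_le hLc hr M _ κ u hM
    _ = cKnest' d Lc M δ * Cs * Real.exp (-δ * (l1 (x - u) + l1 (y - u))) := by
        unfold cKnest'
        ring

/-- [folklore] `LocStencil` survives the full nested kernel dressing of every stencil value as well. -/
theorem locStencil_dressKNestAt {Lc : ℕ} (hLc : 1 ≤ Lc) {r : Fin (d + 1) → ℕ} (hr : r ∈ box (d + 1) Lc) (M : ℕ)
    {S : Fin (d + 1) → (Fin (d + 1) → ℤ) → MKer (d + 1) (Fib d)} {Cs δ : ℝ}
    (hS : LocStencil S Cs δ) (hδ : 0 ≤ δ) :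
    LocStencil (fun κ u => dressKNestAt (toSite r) Lc M (S κ u)) (cKnest d Lc M δ * (cKnest d Lc M δ * Cs)) δ :=
  fun κ u => biLoc_dressKNestAt hLc hr M (hS κ u) hδ

end BondSlot

/-! ## §4 The nested dressing functor `dressNestAt` on `JetData` (blocking `N`, window `Lc^M`) -/

section DressNest

/-- [folklore] **THE NESTED DRESSING FUNCTOR** `dressNestAt`: for an in-block root offset `r ∈ {0,…,N−1}^{d+1}`, `Π̂ᵀ_nest` on the
stencil bond slot and (comp form) on both `inl`-legs of every stencil value and of every second-order table; same rate, constants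
`cKb²·cKb'·Cs` and `cKb²·Cw`.  Decl-by-decl twin of `dressAt` with the nested-normalised projector (NOTE X-an2-42 repair (A)). -/
def dressNestAt {N : ℕ} {Lc : ℕ} (hLc : 1 ≤ Lc) {r : Fin (d + 1) → ℕ} (hr : r ∈ box (d + 1) Lc) (M : ℕ) (J : JetData d N) : JetData d N where
  S := fun κ u => dressKNestAt (toSite r) Lc M (coProjNestAtK (toSite r) Lc M J.S κ u)
  W := fun μ y ν y' => dressKNestAt (toSite r) Lc M (J.W μ y ν y')
  Cs := cKnest d Lc M J.δ * (cKnest d Lc M J.δ * (cKnest' d Lc M J.δ * J.Cs))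
  Cw := cKnest d Lc M J.δ * (cKnest d Lc M J.δ * J.Cw)
  δ := J.δ
  δ_pos := J.δ_pos
  loc := locStencil_dressKNestAt hLc hr M
    (locStencil_coProjNestAtK hLc hr M J.loc J.δ_pos.le) J.δ_pos.le
  loc₂ := fun μ y ν y' => biLoc_dressKNestAt hLc hr M (J.loc₂ μ y ν y') J.δ_pos.le

/-- [folklore] The nested-dressed stencil family, by definition. -/
theorem dressNestAt_S {N : ℕ} {Lc : ℕ} (hLc : 1 ≤ Lc) {r : Fin (d + 1) → ℕ} (hr : r ∈ box (d + 1) Lc) (M : ℕ) (J : JetData d N)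
    (κ : Fin (d + 1)) (u : Fin (d + 1) → ℤ) :
    (dressNestAt hLc hr M J).S κ u = dressKNestAt (toSite r) Lc M (coProjNestAtK (toSite r) Lc M J.S κ u) := rfl

/-- [folklore] The nested-dressed second-order family, by definition. -/
theorem dressNestAt_W {N : ℕ} {Lc : ℕ} (hLc : 1 ≤ Lc) {r : Fin (d + 1) → ℕ} (hr : r ∈ box (d + 1) Lc) (M : ℕ) (J : JetData d N)
    (μ : Fin (d + 1)) (y : Fin (d + 1) → ℤ) (ν : Fin (d + 1)) (y' : Fin (d + 1) → ℤ) :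
    (dressNestAt hLc hr M J).W μ y ν y' = dressKNestAt (toSite r) Lc M (J.W μ y ν y') := rfl

/-- [folklore] The nested dressing keeps the localisation rate. -/
theorem dressNestAt_δ {N : ℕ} {Lc : ℕ} (hLc : 1 ≤ Lc) {r : Fin (d + 1) → ℕ} (hr : r ∈ box (d + 1) Lc) (M : ℕ) (J : JetData d N) :
    (dressNestAt hLc hr M J).δ = J.δ := rfl


end DressNest

end

end Summit.QuantumFields.BalabanUV.Beta.FP.NestedDressingDress
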